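import Summits.BirchSwinnertonDyer.BirchSwinnertonDyer.Theorems.PrintCf2SplitBadTwoStrictDefectAssemblyOfClasses
import Summits.BirchSwinnertonDyer.BirchSwinnertonDyer.Theorems.PrintCf2SplitBadTwoStrictDefectClassOne
import Summits.BirchSwinnertonDyer.BirchSwinnertonDyer.Theorems.PrintCf2SplitBadTwoStrictDefectClassThreeOfFrame
import HarnessLib

/-!
# Crux `PrintCf2.SplitBadTwoRankOneOfFacts` (stmt-BirchSwinnertonDyer-20368), skeleton v13.1 — REGISTERED STUB S3d `stub_strictDefectAtVbar_two`
# (strict versus unramified at `v̄` on the line, the class table `e_δ`) IS A TREE THEOREM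

Cell `bsd-print-cf2`, width seat `bsd-line-cf2-p1-w6` g5 (S3d assembly lane); `--supports stmt-BirchSwinnertonDyer-20368` (stub credit: the theorem's TYPE is
the registered signature AND name of `stub_strictDefectAtVbar_two` of skeleton v13.1 ba1e6df2487b, VERBATIM). HONEST FRAMING: this closes ONE registered stub of the
LEAD's skeleton (S3d), not the crux `SplitBadTwoRankOneOfFacts` (stubs S0′, S0″, S2′-v11, S3a-quad, S3n′ remain); no summit statement is proved by this
seat; BSD is not proved by any of this. No definition, no named fact, no `sorry`.

THE COMPOSITION (tree theorems only): `StrictDefect.strictDefectAtVbar_two_of_classes` (p696075: the case split over `[d]₂` with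
`eδ k₁ k₂ := if k₁ = 1 ∧ k₂ = 3 then 2 else if k₁ = 0 ∧ k₂ = 7 then 1 else 0`, class (ii) `d ≡ 7 (8) ∪ d ≡ 6 (16)` inlined from p693541) applied to
* class (iii)-odd `d ≡ 3 (8)`, `e = 2`: -w3 g12 `StrictDefect.strictDefectAtVbar_two_of_frame_three` (spine I–IV -w3 g11, receptacle `H := W*` p695516 / reader
  p696679, `j := eval ∘ (DC-6)` from -w8 g4 p694414 + -w6 g5 D1/D2 p695417/p695750, `(S_nr)_Γ = 0` -w4 g11 p695592, `Q ≠ 0` -w7 g5 p695439);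
* class (iii)-even `d ≡ 14 (16)`, `e = 1`: -w3 g12 `StrictDefect.strictDefectAtVbar_two_of_frame_even_seven` (same chain, `#(W*)^{D_v̄} = 2`);
* class (i) `d ≡ 2, 10 (16)`, `e = 0`: -w8 g4 `LineDoubleCoset.strictDefectAtVbar_two_of_frame_classOne` (inertial sign-mover ⟹ finite local defect ⟹ -w3 part II).
The value table `e_δ = (2, 0 | 0, 0, 0, 1)` on the keys `(1,3), (1,7) | (0,1), (0,3), (0,5), (0,7)` is scrit R113's table of record.

presearch: not applicable (by-name composition of tree theorems); pattern Greenberg–Vatsal 2000 §2 Cor. 2.3 / Prop. 2.4. beyond-print theorem: no.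

References: [GreenbergVatsal2000] §2 pp. 17–22; [Agboola2007] §3 Prop. 3.2, Thm. 3.1; [GreenbergLNM1716] §3–4.
-/

noncomputable section

open scoped Classical

set_option linter.dupNamespace false
set_option autoImplicit false

open NumberField IsDedekindDomain Field WeierstrassCurve
open Literature.NumberTheory.EllipticCurves Literature.NumberTheory.EllipticCurves.GreenbergSelmer
open Literature.NumberTheory.EllipticCurves.GreenbergVatsal2000 Literature.NumberTheory.EllipticCurves.Castella2018
open Literature.NumberTheory.EllipticCurves.Agboola2007
open Literature.NumberTheory.GaloisRepresentations

namespace Summit.BirchSwinnertonDyer.BirchSwinnertonDyer.Theorems.PrintCf2.StrictDefect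

/-- **S3d `stub_strictDefectAtVbar_two` (skeleton v13.1) — the registered signature, proved.** For ONE class function `eδ` (`2` on `d ≡ 3 (8)`, `1` on
`d ≡ 14 (16)`, `0` on the other four keys of `[d]₂`): on every road-α frame with `Finite W.sha` and the `ℚ`-generator datum, every Greenberg–Vatsal `Λ`-dual
datum `Dnr` of the unramified-at-`v̄` line group (f.g., torsion, `char = (H')`, `H'(0) ≠ 0`, `ord₂ H'(0) = n'`) yields an Agboola STRICT datum `D` with
`Module.Finite`, `D.HasCharValuationAt n` and `n' = n + eδ([d]₂)`. [cite: GreenbergVatsal2000, §2 Cor. 2.3 and Prop. 2.4] [cite: Agboola2007, §3 Prop. 3.2 and Thm. 3.1] -/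
theorem stub_strictDefectAtVbar_two :
    ∃ eδ : ℤ → ℤ → ℤ,
    ∀ (d : ℤ), d ≠ 0 → Squarefree d → d % 4 ≠ 1 →
    ∀ (W : WeierstrassCurve ℚ) [W.IsElliptic] [W.IsGloballyMinimal] (C : VariableChange ℚ),
      C • W = cm7.quadraticTwist (d : ℚ) → W.analyticRank = 1 → Finite W.sha →
    ∀ (K : Type) [Field K] [NumberField K], IsImaginaryQuadratic K →
    ∀ (v vbar : HeightOneSpectrum (𝓞 K)),
      ((2 : ℕ) : 𝓞 K) ∈ v.asIdeal → ((2 : ℕ) : 𝓞 K) ∈ vbar.asIdeal → vbar ≠ v →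
    ∀ (π : (W.baseChange K).endRing), (π : AddMonoid.End (W.baseChange K).geomPoints) * π = π - 2 →
    ∀ (r : ℤ_[2]), r * r = r - 2 →
      (∀ τ ∈ GreenbergSelmer.inertia v, ∀ x : ↥((W.baseChange K).endEigenPrimaryTorsion 2 π r), τ • x = x ∨ τ • x = -x) →
    ∀ (κ' : ZpExtension K 2), κ'.IsUnramifiedOutside vbar → ∀ (γ' : absoluteGaloisGroup K), κ'.IsTopGenerator γ' →
    ∀ (P : W.toAffine.Point) (c₀ : ℕ) (ℓ : ℤ),
      ¬ IsOfFinAddOrder P →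
      (∀ R : W.toAffine.Point, ∃ (k : ℤ) (T : W.toAffine.Point), IsOfFinAddOrder T ∧ R = k • P + T) →
      c₀ ≠ 0 → (W.baseChange ℚ_[2]).IsInReductionKernel (c₀ • W.toPadicPoint 2 P) →
      ‖(W.baseChange ℚ_[2]).padicLogPoint (c₀ • W.toPadicPoint 2 P) / (c₀ : ℚ_[2])‖ = (2 : ℝ) ^ (-ℓ) →
    ∀ (Dnr : GreenbergVatsal2000.DatumDualData κ' γ' ↥((W.baseChange K).endEigenPrimaryTorsion 2 π r)
        (Castella2018.AcSelmer.bdpData ↥((W.baseChange K).endEigenPrimaryTorsion 2 π r) 2 vbar) ∅) (n' : ℕ) (H' : IwasawaAlgebra 2),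
      Module.Finite (IwasawaAlgebra 2) Dnr.X → Module.IsTorsion (IwasawaAlgebra 2) Dnr.X →
      Module.charIdeal (IwasawaAlgebra 2) Dnr.X = Ideal.span {H'} → PowerSeries.constantCoeff H' ≠ 0 →
      (PowerSeries.constantCoeff H').valuation = n' →
    ∃ (D : Agboola2007.RestrictedDualData κ' ↥((W.baseChange K).endEigenPrimaryTorsion 2 π r) vbar γ') (n : ℕ),
      Module.Finite (IwasawaAlgebra 2) D.X ∧ D.HasCharValuationAt n ∧
      (n' : ℤ) = n + eδ (d % 2) ((d / (2 - d % 2)) % 8) :=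
  strictDefectAtVbar_two_of_classes strictDefectAtVbar_two_of_frame_three strictDefectAtVbar_two_of_frame_even_seven
    (fun d hd0 hsq hd4 hcl ↦ LineDoubleCoset.strictDefectAtVbar_two_of_frame_classOne d hd0 hsq hd4 hcl.1 hcl.2)

end Summit.BirchSwinnertonDyer.BirchSwinnertonDyer.Theorems.PrintCf2.StrictDefect

end
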